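import Summits.Ventures.WeilGRH.UniformConductorFloorCellsOne
import HarnessLib

/-!
# GRH arm (rh-explicit, venture WeilGRH): the cell certificate at the `ζ` frontier `4023/5000` — every character mod `q ≥ 70`

Cell `rh-explicit`, WEIL TRACK — GRH ARM (weil-grh-1).  Instance of `UniformFloor.weilPositivityOnChar_of_phi_budget` at
`t = 4023/5000`: `J = 20` cells (`δ = 4023/50000`), prime powers `n = 2, 3, 4` with shift indices `s_n = 8, 13, 17`, and a
`φ`-certificate with **`ρ = 1.2555`** (shift-by-shift budget: `1.9612`).  Consequences: `WeilPositivityOnChar χ (4023/5000)` for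
EVERY character of EVERY modulus **`q ≥ 70`** (even `70`, odd `35`; the tree's `ζ`-transfer floor `450`, the crude floor `144`).

## References

* A. Weil (1952), (11) and the «lemme» p. 262 [Weil1952FormulesExplicites]; H. Yoshida (1992) §2, §6 [Yoshida1992].
-/

noncomputable section

open Complex Filter Set MeasureTheory
open scoped Real Topology ComplexConjugate ArithmeticFunction.vonMangoldt

namespace Summit.Ventures.WeilGRH

open Literature.NumberTheory.LFunctions

namespace UniformFloor

variable {q : ℕ}


/-! ## Shift brackets at `t = 4023/5000`, `J = 20` -/

/-- `s_n δ ≤ log n ≤ (s_n + 1)δ`, `δ = 4023/50000`, `s = 8, 13, 17` at `n = 2, 3, 4`. [folklore] -/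
theorem frontier20_shifts : ∀ n ∈ Finset.range (4 + 1),
    ((sFr20 n : ℤ) : ℝ) * (2 * (4023 / 5000) / ((20 : ℕ) : ℝ)) ≤ Real.log n ∧
      Real.log n ≤ (((sFr20 n : ℤ) : ℝ) + 1) * (2 * (4023 / 5000) / ((20 : ℕ) : ℝ)) := by
  intro n hn
  have hn5 : n < 5 := by have := Finset.mem_range.1 hn; omega
  have h2 := Real.log_two_gt_d9; have h2' := Real.log_two_lt_d9
  have h3 := Real.log_three_gt_d9; have h3' := Real.log_three_lt_d9
  have e4 : Real.log 4 = 2 * Real.log 2 := by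
    rw [show (4 : ℝ) = 2 ^ 2 by norm_num, Real.log_pow]; push_cast; ring
  interval_cases n
  · norm_num [sFr20]
  · norm_num [sFr20]
  · norm_num [sFr20]; constructor <;> linarith
  · norm_num [sFr20]; constructor <;> linarith
  · norm_num [sFr20, e4]; constructor <;> linarith

/-! ## The certificate, cell by cell -/
/-- `3237/10000 ≤ φ_j` on `[0, 20)`. [folklore] -/
theorem frontier20_philo : ∀ i : ℤ, 0 ≤ i → i < ((20 : ℕ) : ℤ) → (3237 / 10000 : ℝ) ≤ phiFr20 i := by
  intro i h0 h1
  push_cast at h1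
  interval_cases i <;> norm_num [phiFr20]

/-- `φ_j ≤ 1`. [folklore] -/
theorem frontier20_phihi : ∀ i : ℤ, phiFr20 i ≤ (1 : ℝ) := by
  intro i
  by_cases h : 0 ≤ i ∧ i < 20
  · obtain ⟨h0, h1⟩ := h
    interval_cases i <;> norm_num [phiFr20]
  · simp only [phiFr20, if_neg h]
    norm_num

/-- `φ_j = 0` off `[0, 20)`. [folklore] -/
theorem frontier20_phiout : ∀ i : ℤ, i < 0 ∨ ((20 : ℕ) : ℤ) ≤ i → phiFr20 i = 0 := by
  intro i hi
  have h : ¬ (0 ≤ i ∧ i < 20) := by omega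
  simp only [phiFr20, if_neg h]

/-- Cell `0` of the `frontier20` certificate (`ρ = 2511/2000`). [folklore] -/
theorem frontier20_cell_0 :
    ∑ n ∈ Finset.range (4 + 1), wbar7 n *
      (max (phiFr20 (((0 : ℕ) : ℤ) - sFr20 n - 1)) (phiFr20 (((0 : ℕ) : ℤ) - sFr20 n)) +
        max (phiFr20 (((0 : ℕ) : ℤ) + sFr20 n)) (phiFr20 (((0 : ℕ) : ℤ) + sFr20 n + 1))) ≤
      (2511 / 2000 : ℝ) * phiFr20 ((0 : ℕ) : ℤ) := by
  simp only [Finset.sum_range_succ, Finset.sum_range_zero, wbar7, phiFr20, sFr20]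
  norm_num

/-- Cell `1` of the `frontier20` certificate (`ρ = 2511/2000`). [folklore] -/
theorem frontier20_cell_1 :
    ∑ n ∈ Finset.range (4 + 1), wbar7 n *
      (max (phiFr20 (((1 : ℕ) : ℤ) - sFr20 n - 1)) (phiFr20 (((1 : ℕ) : ℤ) - sFr20 n)) +
        max (phiFr20 (((1 : ℕ) : ℤ) + sFr20 n)) (phiFr20 (((1 : ℕ) : ℤ) + sFr20 n + 1))) ≤
      (2511 / 2000 : ℝ) * phiFr20 ((1 : ℕ) : ℤ) := by
  simp only [Finset.sum_range_succ, Finset.sum_range_zero, wbar7, phiFr20, sFr20]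
  norm_num

/-- Cell `2` of the `frontier20` certificate (`ρ = 2511/2000`). [folklore] -/
theorem frontier20_cell_2 :
    ∑ n ∈ Finset.range (4 + 1), wbar7 n *
      (max (phiFr20 (((2 : ℕ) : ℤ) - sFr20 n - 1)) (phiFr20 (((2 : ℕ) : ℤ) - sFr20 n)) +
        max (phiFr20 (((2 : ℕ) : ℤ) + sFr20 n)) (phiFr20 (((2 : ℕ) : ℤ) + sFr20 n + 1))) ≤
      (2511 / 2000 : ℝ) * phiFr20 ((2 : ℕ) : ℤ) := by
  simp only [Finset.sum_range_succ, Finset.sum_range_zero, wbar7, phiFr20, sFr20]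
  norm_num

/-- Cell `3` of the `frontier20` certificate (`ρ = 2511/2000`). [folklore] -/
theorem frontier20_cell_3 :
    ∑ n ∈ Finset.range (4 + 1), wbar7 n *
      (max (phiFr20 (((3 : ℕ) : ℤ) - sFr20 n - 1)) (phiFr20 (((3 : ℕ) : ℤ) - sFr20 n)) +
        max (phiFr20 (((3 : ℕ) : ℤ) + sFr20 n)) (phiFr20 (((3 : ℕ) : ℤ) + sFr20 n + 1))) ≤
      (2511 / 2000 : ℝ) * phiFr20 ((3 : ℕ) : ℤ) := by
  simp only [Finset.sum_range_succ, Finset.sum_range_zero, wbar7, phiFr20, sFr20]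
  norm_num

/-- Cell `4` of the `frontier20` certificate (`ρ = 2511/2000`). [folklore] -/
theorem frontier20_cell_4 :
    ∑ n ∈ Finset.range (4 + 1), wbar7 n *
      (max (phiFr20 (((4 : ℕ) : ℤ) - sFr20 n - 1)) (phiFr20 (((4 : ℕ) : ℤ) - sFr20 n)) +
        max (phiFr20 (((4 : ℕ) : ℤ) + sFr20 n)) (phiFr20 (((4 : ℕ) : ℤ) + sFr20 n + 1))) ≤
      (2511 / 2000 : ℝ) * phiFr20 ((4 : ℕ) : ℤ) := by
  simp only [Finset.sum_range_succ, Finset.sum_range_zero, wbar7, phiFr20, sFr20]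
  norm_num

/-- Cell `5` of the `frontier20` certificate (`ρ = 2511/2000`). [folklore] -/
theorem frontier20_cell_5 :
    ∑ n ∈ Finset.range (4 + 1), wbar7 n *
      (max (phiFr20 (((5 : ℕ) : ℤ) - sFr20 n - 1)) (phiFr20 (((5 : ℕ) : ℤ) - sFr20 n)) +
        max (phiFr20 (((5 : ℕ) : ℤ) + sFr20 n)) (phiFr20 (((5 : ℕ) : ℤ) + sFr20 n + 1))) ≤
      (2511 / 2000 : ℝ) * phiFr20 ((5 : ℕ) : ℤ) := by
  simp only [Finset.sum_range_succ, Finset.sum_range_zero, wbar7, phiFr20, sFr20]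
  norm_num

/-- Cell `6` of the `frontier20` certificate (`ρ = 2511/2000`). [folklore] -/
theorem frontier20_cell_6 :
    ∑ n ∈ Finset.range (4 + 1), wbar7 n *
      (max (phiFr20 (((6 : ℕ) : ℤ) - sFr20 n - 1)) (phiFr20 (((6 : ℕ) : ℤ) - sFr20 n)) +
        max (phiFr20 (((6 : ℕ) : ℤ) + sFr20 n)) (phiFr20 (((6 : ℕ) : ℤ) + sFr20 n + 1))) ≤
      (2511 / 2000 : ℝ) * phiFr20 ((6 : ℕ) : ℤ) := by
  simp only [Finset.sum_range_succ, Finset.sum_range_zero, wbar7, phiFr20, sFr20]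
  norm_num

/-- Cell `7` of the `frontier20` certificate (`ρ = 2511/2000`). [folklore] -/
theorem frontier20_cell_7 :
    ∑ n ∈ Finset.range (4 + 1), wbar7 n *
      (max (phiFr20 (((7 : ℕ) : ℤ) - sFr20 n - 1)) (phiFr20 (((7 : ℕ) : ℤ) - sFr20 n)) +
        max (phiFr20 (((7 : ℕ) : ℤ) + sFr20 n)) (phiFr20 (((7 : ℕ) : ℤ) + sFr20 n + 1))) ≤
      (2511 / 2000 : ℝ) * phiFr20 ((7 : ℕ) : ℤ) := by
  simp only [Finset.sum_range_succ, Finset.sum_range_zero, wbar7, phiFr20, sFr20]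
  norm_num

/-- Cell `8` of the `frontier20` certificate (`ρ = 2511/2000`). [folklore] -/
theorem frontier20_cell_8 :
    ∑ n ∈ Finset.range (4 + 1), wbar7 n *
      (max (phiFr20 (((8 : ℕ) : ℤ) - sFr20 n - 1)) (phiFr20 (((8 : ℕ) : ℤ) - sFr20 n)) +
        max (phiFr20 (((8 : ℕ) : ℤ) + sFr20 n)) (phiFr20 (((8 : ℕ) : ℤ) + sFr20 n + 1))) ≤
      (2511 / 2000 : ℝ) * phiFr20 ((8 : ℕ) : ℤ) := by
  simp only [Finset.sum_range_succ, Finset.sum_range_zero, wbar7, phiFr20, sFr20]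
  norm_num

/-- Cell `9` of the `frontier20` certificate (`ρ = 2511/2000`). [folklore] -/
theorem frontier20_cell_9 :
    ∑ n ∈ Finset.range (4 + 1), wbar7 n *
      (max (phiFr20 (((9 : ℕ) : ℤ) - sFr20 n - 1)) (phiFr20 (((9 : ℕ) : ℤ) - sFr20 n)) +
        max (phiFr20 (((9 : ℕ) : ℤ) + sFr20 n)) (phiFr20 (((9 : ℕ) : ℤ) + sFr20 n + 1))) ≤
      (2511 / 2000 : ℝ) * phiFr20 ((9 : ℕ) : ℤ) := by
  simp only [Finset.sum_range_succ, Finset.sum_range_zero, wbar7, phiFr20, sFr20]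
  norm_num

/-- Cell `10` of the `frontier20` certificate (`ρ = 2511/2000`). [folklore] -/
theorem frontier20_cell_10 :
    ∑ n ∈ Finset.range (4 + 1), wbar7 n *
      (max (phiFr20 (((10 : ℕ) : ℤ) - sFr20 n - 1)) (phiFr20 (((10 : ℕ) : ℤ) - sFr20 n)) +
        max (phiFr20 (((10 : ℕ) : ℤ) + sFr20 n)) (phiFr20 (((10 : ℕ) : ℤ) + sFr20 n + 1))) ≤
      (2511 / 2000 : ℝ) * phiFr20 ((10 : ℕ) : ℤ) := by
  simp only [Finset.sum_range_succ, Finset.sum_range_zero, wbar7, phiFr20, sFr20]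
  norm_num

/-- Cell `11` of the `frontier20` certificate (`ρ = 2511/2000`). [folklore] -/
theorem frontier20_cell_11 :
    ∑ n ∈ Finset.range (4 + 1), wbar7 n *
      (max (phiFr20 (((11 : ℕ) : ℤ) - sFr20 n - 1)) (phiFr20 (((11 : ℕ) : ℤ) - sFr20 n)) +
        max (phiFr20 (((11 : ℕ) : ℤ) + sFr20 n)) (phiFr20 (((11 : ℕ) : ℤ) + sFr20 n + 1))) ≤
      (2511 / 2000 : ℝ) * phiFr20 ((11 : ℕ) : ℤ) := by
  simp only [Finset.sum_range_succ, Finset.sum_range_zero, wbar7, phiFr20, sFr20]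
  norm_num

/-- Cell `12` of the `frontier20` certificate (`ρ = 2511/2000`). [folklore] -/
theorem frontier20_cell_12 :
    ∑ n ∈ Finset.range (4 + 1), wbar7 n *
      (max (phiFr20 (((12 : ℕ) : ℤ) - sFr20 n - 1)) (phiFr20 (((12 : ℕ) : ℤ) - sFr20 n)) +
        max (phiFr20 (((12 : ℕ) : ℤ) + sFr20 n)) (phiFr20 (((12 : ℕ) : ℤ) + sFr20 n + 1))) ≤
      (2511 / 2000 : ℝ) * phiFr20 ((12 : ℕ) : ℤ) := by
  simp only [Finset.sum_range_succ, Finset.sum_range_zero, wbar7, phiFr20, sFr20]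
  norm_num

/-- Cell `13` of the `frontier20` certificate (`ρ = 2511/2000`). [folklore] -/
theorem frontier20_cell_13 :
    ∑ n ∈ Finset.range (4 + 1), wbar7 n *
      (max (phiFr20 (((13 : ℕ) : ℤ) - sFr20 n - 1)) (phiFr20 (((13 : ℕ) : ℤ) - sFr20 n)) +
        max (phiFr20 (((13 : ℕ) : ℤ) + sFr20 n)) (phiFr20 (((13 : ℕ) : ℤ) + sFr20 n + 1))) ≤
      (2511 / 2000 : ℝ) * phiFr20 ((13 : ℕ) : ℤ) := by
  simp only [Finset.sum_range_succ, Finset.sum_range_zero, wbar7, phiFr20, sFr20]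
  norm_num

/-- Cell `14` of the `frontier20` certificate (`ρ = 2511/2000`). [folklore] -/
theorem frontier20_cell_14 :
    ∑ n ∈ Finset.range (4 + 1), wbar7 n *
      (max (phiFr20 (((14 : ℕ) : ℤ) - sFr20 n - 1)) (phiFr20 (((14 : ℕ) : ℤ) - sFr20 n)) +
        max (phiFr20 (((14 : ℕ) : ℤ) + sFr20 n)) (phiFr20 (((14 : ℕ) : ℤ) + sFr20 n + 1))) ≤
      (2511 / 2000 : ℝ) * phiFr20 ((14 : ℕ) : ℤ) := by
  simp only [Finset.sum_range_succ, Finset.sum_range_zero, wbar7, phiFr20, sFr20]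
  norm_num

/-- Cell `15` of the `frontier20` certificate (`ρ = 2511/2000`). [folklore] -/
theorem frontier20_cell_15 :
    ∑ n ∈ Finset.range (4 + 1), wbar7 n *
      (max (phiFr20 (((15 : ℕ) : ℤ) - sFr20 n - 1)) (phiFr20 (((15 : ℕ) : ℤ) - sFr20 n)) +
        max (phiFr20 (((15 : ℕ) : ℤ) + sFr20 n)) (phiFr20 (((15 : ℕ) : ℤ) + sFr20 n + 1))) ≤
      (2511 / 2000 : ℝ) * phiFr20 ((15 : ℕ) : ℤ) := by
  simp only [Finset.sum_range_succ, Finset.sum_range_zero, wbar7, phiFr20, sFr20]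
  norm_num

/-- Cell `16` of the `frontier20` certificate (`ρ = 2511/2000`). [folklore] -/
theorem frontier20_cell_16 :
    ∑ n ∈ Finset.range (4 + 1), wbar7 n *
      (max (phiFr20 (((16 : ℕ) : ℤ) - sFr20 n - 1)) (phiFr20 (((16 : ℕ) : ℤ) - sFr20 n)) +
        max (phiFr20 (((16 : ℕ) : ℤ) + sFr20 n)) (phiFr20 (((16 : ℕ) : ℤ) + sFr20 n + 1))) ≤
      (2511 / 2000 : ℝ) * phiFr20 ((16 : ℕ) : ℤ) := by
  simp only [Finset.sum_range_succ, Finset.sum_range_zero, wbar7, phiFr20, sFr20]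
  norm_num

/-- Cell `17` of the `frontier20` certificate (`ρ = 2511/2000`). [folklore] -/
theorem frontier20_cell_17 :
    ∑ n ∈ Finset.range (4 + 1), wbar7 n *
      (max (phiFr20 (((17 : ℕ) : ℤ) - sFr20 n - 1)) (phiFr20 (((17 : ℕ) : ℤ) - sFr20 n)) +
        max (phiFr20 (((17 : ℕ) : ℤ) + sFr20 n)) (phiFr20 (((17 : ℕ) : ℤ) + sFr20 n + 1))) ≤
      (2511 / 2000 : ℝ) * phiFr20 ((17 : ℕ) : ℤ) := by
  simp only [Finset.sum_range_succ, Finset.sum_range_zero, wbar7, phiFr20, sFr20]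
  norm_num

/-- Cell `18` of the `frontier20` certificate (`ρ = 2511/2000`). [folklore] -/
theorem frontier20_cell_18 :
    ∑ n ∈ Finset.range (4 + 1), wbar7 n *
      (max (phiFr20 (((18 : ℕ) : ℤ) - sFr20 n - 1)) (phiFr20 (((18 : ℕ) : ℤ) - sFr20 n)) +
        max (phiFr20 (((18 : ℕ) : ℤ) + sFr20 n)) (phiFr20 (((18 : ℕ) : ℤ) + sFr20 n + 1))) ≤
      (2511 / 2000 : ℝ) * phiFr20 ((18 : ℕ) : ℤ) := by
  simp only [Finset.sum_range_succ, Finset.sum_range_zero, wbar7, phiFr20, sFr20]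
  norm_num

/-- Cell `19` of the `frontier20` certificate (`ρ = 2511/2000`). [folklore] -/
theorem frontier20_cell_19 :
    ∑ n ∈ Finset.range (4 + 1), wbar7 n *
      (max (phiFr20 (((19 : ℕ) : ℤ) - sFr20 n - 1)) (phiFr20 (((19 : ℕ) : ℤ) - sFr20 n)) +
        max (phiFr20 (((19 : ℕ) : ℤ) + sFr20 n)) (phiFr20 (((19 : ℕ) : ℤ) + sFr20 n + 1))) ≤
      (2511 / 2000 : ℝ) * phiFr20 ((19 : ℕ) : ℤ) := by
  simp only [Finset.sum_range_succ, Finset.sum_range_zero, wbar7, phiFr20, sFr20]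
  norm_num

/-- **The `frontier20` certificate**: all `20` cell inequalities `Σ_n w̄_n (A_{n,j} + B_{n,j}) ≤ ρ φ_j`. [folklore] -/
theorem frontier20_cert : ∀ j ∈ Finset.range 20,
    ∑ n ∈ Finset.range (4 + 1), wbar7 n *
      (max (phiFr20 ((j : ℤ) - sFr20 n - 1)) (phiFr20 ((j : ℤ) - sFr20 n)) +
        max (phiFr20 ((j : ℤ) + sFr20 n)) (phiFr20 ((j : ℤ) + sFr20 n + 1))) ≤ (2511 / 2000 : ℝ) * phiFr20 (j : ℤ) := by
  intro j hj
  rw [Finset.mem_range] at hj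
  interval_cases j
  exacts [frontier20_cell_0, frontier20_cell_1, frontier20_cell_2, frontier20_cell_3, frontier20_cell_4, frontier20_cell_5, frontier20_cell_6, frontier20_cell_7, frontier20_cell_8, frontier20_cell_9, frontier20_cell_10, frontier20_cell_11, frontier20_cell_12, frontier20_cell_13, frontier20_cell_14, frontier20_cell_15, frontier20_cell_16, frontier20_cell_17, frontier20_cell_18, frontier20_cell_19]
/-! ## The floors at the frontier -/

/-- `log 70 ≥ 4.2391693`, `log 35 ≥ 3.5460222`. [folklore] -/
theorem log_70_35_ge : (4.2391693 : ℝ) ≤ Real.log 70 ∧ (3.5460222 : ℝ) ≤ Real.log 35 := by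
  have h2 := Real.log_two_gt_d9
  have h5 := Real.log_five_gt_d9
  have h7 := log_seven_ge
  have e70 : Real.log 70 = Real.log 2 + Real.log 5 + Real.log 7 := by
    rw [show (70 : ℝ) = 2 * 5 * 7 by norm_num, Real.log_mul (by norm_num) (by norm_num),
      Real.log_mul (by norm_num) (by norm_num)]
  have e35 : Real.log 35 = Real.log 5 + Real.log 7 := by
    rw [show (35 : ℝ) = 5 * 7 by norm_num, Real.log_mul (by norm_num) (by norm_num)]
  constructor
  · rw [e70]; linarith
  · rw [e35]; linarith

/-- **Every EVEN character of modulus `q ≥ 70` satisfies `WeilPositivityOnChar χ (4023/5000)`** (cell certificate `ρ = 1.2555`;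
budget `1.1447299 + 4.22745354 − (4 − 8046/5000) + 1.2555 = 4.2368835 ≤ 4.2391693 ≤ log 70`).
[cite: Weil1952FormulesExplicites, (11) and the «lemme» p. 262; Yoshida1992, §6] -/
theorem weilPositivityOnChar_frontier_of_even_ge_70 (hq : 70 ≤ q) (χ : DirichletCharacter ℂ q) (hχ : χ.Even) :
    WeilPositivityOnChar χ (4023 / 5000) := by
  have hq1 : q ≠ 1 := by omega
  have hlog := log_70_35_ge.1.trans (log_le_log_natCast (by norm_num) hq)
  have hπ := Literature.Analysis.SpecialFunctions.Real.log_pi_le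
  refine weilPositivityOnChar_of_phi_budget hq1 χ (charParity_of_even hχ) (by norm_num) exp_frontier_le_five 1
    psi_even_ge (by norm_num : 0 < 20) phiFr20 (by norm_num : (0 : ℝ) < (3237 / 10000 : ℝ)) frontier20_philo frontier20_phihi
    frontier20_phiout sFr20 frontier20_shifts wbar7 (wbar7_ge 4 (by norm_num)) frontier20_cert ?_
  simp only [Finset.sum_range_one, Nat.cast_zero]
  norm_num
  linarith

/-- **Every ODD character of modulus `q ≥ 35` satisfies `WeilPositivityOnChar χ (4023/5000)`** (budget
`1.1447299 + 1.08586154 + 1.2555 = 3.4860915 ≤ 3.5460222 ≤ log 35`; method floor `33`).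
[cite: Weil1952FormulesExplicites, (11) and the «lemme» p. 262; Yoshida1992, §6] -/
theorem weilPositivityOnChar_frontier_of_odd_ge_35 [NeZero q] (hq : 35 ≤ q) (χ : DirichletCharacter ℂ q)
    (hχ : χ.Odd) : WeilPositivityOnChar χ (4023 / 5000) := by
  have hq1 : q ≠ 1 := by omega
  have hlog := log_70_35_ge.2.trans (log_le_log_natCast (by norm_num) hq)
  have hπ := Literature.Analysis.SpecialFunctions.Real.log_pi_le
  refine weilPositivityOnChar_of_phi_budget hq1 χ (charParity_of_odd hχ) (by norm_num) exp_frontier_le_five 0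
    psi_odd_ge (by norm_num : 0 < 20) phiFr20 (by norm_num : (0 : ℝ) < (3237 / 10000 : ℝ)) frontier20_philo frontier20_phihi
    frontier20_phiout sFr20 frontier20_shifts wbar7 (wbar7_ge 4 (by norm_num)) frontier20_cert ?_
  simp only [Finset.sum_range_zero]
  linarith

/-- **UNIFORM FLOOR AT THE `ζ` FRONTIER (cell certificate): every Dirichlet character of every modulus `q ≥ 70`
satisfies `WeilPositivityOnChar χ (4023/5000)`** (hence every rung `t ≤ 4023/5000`); no `ζ` input.
[cite: Weil1952FormulesExplicites, (11) and the «lemme» p. 262; Yoshida1992, §6] -/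
theorem weilPositivityOnChar_frontier_of_ge_70 (hq : 70 ≤ q) (χ : DirichletCharacter ℂ q) :
    WeilPositivityOnChar χ (4023 / 5000) := by
  haveI : NeZero q := ⟨by omega⟩
  rcases χ.even_or_odd with h | h
  · exact weilPositivityOnChar_frontier_of_even_ge_70 hq χ h
  · exact weilPositivityOnChar_frontier_of_odd_ge_35 (by omega) χ h

end UniformFloor

end Summit.Ventures.WeilGRH

end
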